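import Summits.ResolutionOfSingularities.ResolutionOfSingularities.Theorems.MarkedTransferCampaignW46CentreThread
import Summits.ResolutionOfSingularities.ResolutionOfSingularities.Theorems.MarkedTransferCampaignW46MohWindowSurfaceTameExitBound
import HarnessLib

/-!
# [OURS · L1 W4.6] TERMINATION AND EXIT BOUNDS FROM A POINT WEIGHT — regime-generic criteria (cell res-hironaka, LADDER-RESOLUTION rung L,
# D-0089; seat res-L1-s46-pv-5 gen 5; host MarkedTransfer, `--supports stmt-ResolutionOfSingularities-16155 --as helper`)

HONEST FRAMING. Nothing here is a statement of H. Hironaka's manuscript [Hironaka2017] and nothing here asserts that any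
statement of it holds. Regime-GENERIC packaging of the two arguments this seat used for the surface window (rung (iii-2)), for re-use
by the other W4.6 rungs: given a regime `Rg` whose states have finite singular loci of closed points and an `ℕ`-valued POINT WEIGHT
`w(A, E, x)` which, at every in-regime §2.1-permissible blow-up, is TRANSPORTED off the centre and DROPS at the singular points over the
centre —
* THREAD CRITERION (`permissiblyTerminates_of_weight`): `PermissiblyTerminates Rg` — by the centre thread (`…CentreThread.lean`,
  König): along the thread the weight is non-increasing and drops at each of the infinitely many hits. No child count, no multiset order.
* EXIT BOUND (`finLocalExitBound_of_weight`): if moreover at most `N` singular points lie over each admitted centre, then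
  `FinLocalExitBound Rg` with `β(A, E, x) = Σ_{ξ ∈ Sing(E)} (N + 1)^{w(ξ)}` and every finite in-regime sequence has length `≤ β`
  (`FinPermissibleRun.len_le_potential_of_weight`; the potential step is `sum_pow_val_succ_add_one_le` of `…TameExitBound.lean`).
Instances in the tree: `w = residualOrder` on `Regime.mohWindowSurfaceTame` (res-D-pv-050's laws; `…TameExitBound.lean`), the `0/1/2` weight
at `p = 2` (`…TerminationTwo/ExitBoundTwo.lean`), `#Sing`/cusp index on the curve window (`…CuspStaircase*.lean`). AI-written; AI review is
weaker than expert review. No `sorry`; axioms standard.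
-/

noncomputable section

set_option linter.dupNamespace false -- mandated namespace of this single-conjunct summit

open CategoryTheory AlgebraicGeometry TopologicalSpace IsLocalRing

namespace Summit.ResolutionOfSingularities.ResolutionOfSingularities.Theorems

namespace CampaignW46

open Literature.AlgebraicGeometry.Resolution
open Literature.AlgebraicGeometry.Hironaka2017.S02Preliminaries
open Literature.AlgebraicGeometry.Hironaka2017.Datum
open Scheme.IdealSheafData

universe u

variable {p : ℕ} [Fact p.Prime] {K : Type u} [Field K] [CharP K p]

/-! ## 1. The thread criterion for termination -/

/-- **[OURS · L1 W4.6] TERMINATION FROM A POINT WEIGHT (thread criterion).** Let `Rg` be a regime all of whose states have a finite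
singular locus of closed points, and `w(A, E, x) ∈ ℕ` a weight such that for every §2.1-permissible blow-up `π` of a state `(A, E) ∈ Rg`
with transform `(A′, E′) ∈ Rg`: at singular points `x′` of `E′` NOT over the centre `w(x′) ≤ w(π x′)`, and at singular points over the
centre `w(x′) < w(π x′)`. Then `PermissiblyTerminates Rg`. Proof: the centre thread of an infinite in-regime sequence
(`PermissibleRun.exists_centre_thread`) carries a non-increasing weight that drops infinitely often. NOT a statement of the manuscript.
[folklore] -/
theorem permissiblyTerminates_of_weight {Rg : Regime p K}
    (hfin : ∀ (A : AmbientDatum p K) (E : IdealExponent A.Z), Rg A E → E.sing.Finite)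
    (hcl : ∀ (A : AmbientDatum p K) (E : IdealExponent A.Z), Rg A E →
      E.sing ⊆ Literature.AlgebraicGeometry.Hironaka2017.S02Preliminaries.closedPoints A.Z)
    (w : ∀ (A : AmbientDatum p K) (E : IdealExponent A.Z), A.Z → ℕ)
    (hoff : ∀ (A A' : AmbientDatum p K) (E : IdealExponent A.Z) (D : Closeds A.Z) (π : A'.Z ⟶ A.Z),
      IsBlowup π (vanishingIdeal D) → E.IsPermissibleCentre A.hom D → Rg A E → Rg A' (E.transform π D) →
      ∀ x' ∈ (E.transform π D).sing, π.base x' ∉ (D : Set A.Z) → w A' (E.transform π D) x' ≤ w A E (π.base x'))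
    (hon : ∀ (A A' : AmbientDatum p K) (E : IdealExponent A.Z) (D : Closeds A.Z) (π : A'.Z ⟶ A.Z),
      IsBlowup π (vanishingIdeal D) → E.IsPermissibleCentre A.hom D → Rg A E → Rg A' (E.transform π D) →
      ∀ x' ∈ (E.transform π D).sing, π.base x' ∈ (D : Set A.Z) → w A' (E.transform π D) x' < w A E (π.base x')) :
    PermissiblyTerminates Rg := by
  classical
  intro r hr
  obtain ⟨b, hbS, hbπ, hhit⟩ := r.exists_centre_thread (fun k => hfin _ _ (hr k)) (fun k => hcl _ _ (hr k))
  let v : ℕ → ℕ := fun k => w (r.A k) (r.E k) (b k)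
  -- one step along the thread, stated for an arbitrary next stage `E₁ = transform`
  have key : ∀ k (E₁ : IdealExponent (r.A (k + 1)).Z) (heq : E₁ = (r.E k).transform (r.π k) (r.D k))
      (h₁ : Rg (r.A (k + 1)) E₁) (hb₁ : b (k + 1) ∈ E₁.sing),
      w (r.A (k + 1)) E₁ (b (k + 1)) ≤ v k ∧ (b k ∈ (r.D k : Set (r.A k).Z) → w (r.A (k + 1)) E₁ (b (k + 1)) < v k) := by
    intro k E₁ heq h₁ hb₁
    subst heq
    by_cases hbk : b k ∈ (r.D k : Set (r.A k).Z)
    · have hover : (r.π k).base (b (k + 1)) ∈ (r.D k : Set (r.A k).Z) := by rw [hbπ k]; exact hbk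
      have := hon _ _ _ _ (r.π k) (r.blowup k) (r.permissible k) (hr k) h₁ _ hb₁ hover
      rw [hbπ k] at this
      exact ⟨this.le, fun _ => this⟩
    · have hover : (r.π k).base (b (k + 1)) ∉ (r.D k : Set (r.A k).Z) := by rw [hbπ k]; exact hbk
      have := hoff _ _ _ _ (r.π k) (r.blowup k) (r.permissible k) (hr k) h₁ _ hb₁ hover
      rw [hbπ k] at this
      exact ⟨this, fun h => absurd h hbk⟩
  have hmono : ∀ k, v (k + 1) ≤ v k := fun k => (key k (r.E (k + 1)) (r.E_succ k) (hr (k + 1)) (hbS (k + 1))).1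
  have hdrop : ∀ k, b k ∈ (r.D k : Set (r.A k).Z) → v (k + 1) < v k := fun k =>
    (key k (r.E (k + 1)) (r.E_succ k) (hr (k + 1)) (hbS (k + 1))).2
  have hmono' : ∀ k j, v (k + j) ≤ v k := by
    intro k j
    induction j with
    | zero => exact le_rfl
    | succ j ih => exact (hmono (k + j)).trans ih
  have hacc : ∀ n, ∃ k, v k + n ≤ v 0 := by
    intro n
    induction n with
    | zero => exact ⟨0, by omega⟩
    | succ n ih =>
      obtain ⟨k, hvk⟩ := ih
      obtain ⟨k', hkk', hbk'⟩ := hhit k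
      have h1 : v k' ≤ v k := by
        have := hmono' k (k' - k)
        rwa [Nat.add_sub_cancel' hkk'] at this
      have h2 := hdrop k' hbk'
      exact ⟨k' + 1, by omega⟩
  obtain ⟨k, hk⟩ := hacc (v 0 + 1)
  omega

/-! ## 2. The exit bound from a point weight and a child count -/

/-- **[OURS · L1 W4.6] LENGTH BOUND FROM A POINT WEIGHT AND A CHILD COUNT.** In the situation of `permissiblyTerminates_of_weight` with the
weight exactly TRANSPORTED off the centre and at most `N` singular points over each admitted centre, every finite §2.1-permissible
sequence inside `Rg` has length `≤ Σ_{ξ ∈ Sing(E₀)} (N + 1)^{w(ξ)}`. NOT a statement of the manuscript. [folklore] -/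
theorem FinPermissibleRun.len_le_potential_of_weight {Rg : Regime p K}
    (hfin : ∀ (A : AmbientDatum p K) (E : IdealExponent A.Z), Rg A E → E.sing.Finite)
    (hcl : ∀ (A : AmbientDatum p K) (E : IdealExponent A.Z), Rg A E →
      E.sing ⊆ Literature.AlgebraicGeometry.Hironaka2017.S02Preliminaries.closedPoints A.Z)
    (w : ∀ (A : AmbientDatum p K) (E : IdealExponent A.Z), A.Z → ℕ) (N : ℕ)
    (hoff : ∀ (A A' : AmbientDatum p K) (E : IdealExponent A.Z) (D : Closeds A.Z) (π : A'.Z ⟶ A.Z),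
      IsBlowup π (vanishingIdeal D) → E.IsPermissibleCentre A.hom D → Rg A E → Rg A' (E.transform π D) →
      ∀ x' ∈ (E.transform π D).sing, π.base x' ∉ (D : Set A.Z) → w A' (E.transform π D) x' = w A E (π.base x'))
    (hon : ∀ (A A' : AmbientDatum p K) (E : IdealExponent A.Z) (D : Closeds A.Z) (π : A'.Z ⟶ A.Z),
      IsBlowup π (vanishingIdeal D) → E.IsPermissibleCentre A.hom D → Rg A E → Rg A' (E.transform π D) →
      ∀ x' ∈ (E.transform π D).sing, π.base x' ∈ (D : Set A.Z) → w A' (E.transform π D) x' < w A E (π.base x'))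
    (hN : ∀ (A A' : AmbientDatum p K) (E : IdealExponent A.Z) (D : Closeds A.Z) (π : A'.Z ⟶ A.Z),
      IsBlowup π (vanishingIdeal D) → E.IsPermissibleCentre A.hom D → Rg A E → Rg A' (E.transform π D) →
      ((E.transform π D).sing ∩ π.base ⁻¹' (D : Set A.Z)).Finite ∧ ((E.transform π D).sing ∩ π.base ⁻¹' (D : Set A.Z)).ncard ≤ N)
    (r : FinPermissibleRun p K) (hr : ∀ k, k ≤ r.len → Rg (r.A k) (r.E k)) :
    r.len ≤ ∑ x ∈ (hfin _ _ (hr 0 (Nat.zero_le _))).toFinset, (N + 1) ^ w (r.A 0) (r.E 0) x := by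
  classical
  have key : ∀ k (hk : Rg (r.A k) (r.E k)) (E₁ : IdealExponent (r.A (k + 1)).Z) (h₁ : Rg (r.A (k + 1)) E₁)
      (heq : E₁ = (r.E k).transform (r.π k) (r.D k))
      (hperm : (r.E k).IsPermissibleCentre (r.A k).hom (r.D k)) (hbl : IsBlowup (r.π k) (vanishingIdeal (r.D k))),
      (∑ x ∈ (hfin _ _ h₁).toFinset, (N + 1) ^ w (r.A (k + 1)) E₁ x) + 1 ≤
        ∑ x ∈ (hfin _ _ hk).toFinset, (N + 1) ^ w (r.A k) (r.E k) x := by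
    intro k hk E₁ h₁ heq hperm hbl
    subst heq
    exact sum_pow_val_succ_add_one_le (r.π k) hbl hperm (hfin _ _ hk) (hcl _ _ hk) (hfin _ _ h₁) _ _
      (hoff _ _ _ _ (r.π k) hbl hperm hk h₁) (hon _ _ _ _ (r.π k) hbl hperm hk h₁) N (hN _ _ _ _ (r.π k) hbl hperm hk h₁)
  have htel : ∀ k (hk : k ≤ r.len), (∑ x ∈ (hfin _ _ (hr k hk)).toFinset, (N + 1) ^ w (r.A k) (r.E k) x) + k ≤
      ∑ x ∈ (hfin _ _ (hr 0 (Nat.zero_le _))).toFinset, (N + 1) ^ w (r.A 0) (r.E 0) x := by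
    intro k
    induction k with
    | zero => intro hk; simp
    | succ k ih =>
      intro hk1
      have hk : k ≤ r.len := Nat.le_of_succ_le hk1
      have hklt : k < r.len := hk1
      have hstep := key k (hr k hk) (r.E (k + 1)) (hr (k + 1) hk1) (r.E_succ k hklt) (r.permissible k hklt) (r.blowup k hklt)
      have := ih hk
      omega
  have := htel r.len le_rfl
  omega

/-- **[OURS · L1 W4.6] THE EXIT-BOUND FORM FROM A POINT WEIGHT AND A CHILD COUNT**: `FinLocalExitBound Rg` with
`β(A, E, x) = Σ_{ξ ∈ Sing(E)} (N + 1)^{w(ξ)}` (`0` if `Sing(E)` is infinite). NOT a statement of the manuscript. [folklore] -/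
theorem finLocalExitBound_of_weight {Rg : Regime p K}
    (hfin : ∀ (A : AmbientDatum p K) (E : IdealExponent A.Z), Rg A E → E.sing.Finite)
    (hcl : ∀ (A : AmbientDatum p K) (E : IdealExponent A.Z), Rg A E →
      E.sing ⊆ Literature.AlgebraicGeometry.Hironaka2017.S02Preliminaries.closedPoints A.Z)
    (w : ∀ (A : AmbientDatum p K) (E : IdealExponent A.Z), A.Z → ℕ) (N : ℕ)
    (hoff : ∀ (A A' : AmbientDatum p K) (E : IdealExponent A.Z) (D : Closeds A.Z) (π : A'.Z ⟶ A.Z),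
      IsBlowup π (vanishingIdeal D) → E.IsPermissibleCentre A.hom D → Rg A E → Rg A' (E.transform π D) →
      ∀ x' ∈ (E.transform π D).sing, π.base x' ∉ (D : Set A.Z) → w A' (E.transform π D) x' = w A E (π.base x'))
    (hon : ∀ (A A' : AmbientDatum p K) (E : IdealExponent A.Z) (D : Closeds A.Z) (π : A'.Z ⟶ A.Z),
      IsBlowup π (vanishingIdeal D) → E.IsPermissibleCentre A.hom D → Rg A E → Rg A' (E.transform π D) →
      ∀ x' ∈ (E.transform π D).sing, π.base x' ∈ (D : Set A.Z) → w A' (E.transform π D) x' < w A E (π.base x'))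
    (hN : ∀ (A A' : AmbientDatum p K) (E : IdealExponent A.Z) (D : Closeds A.Z) (π : A'.Z ⟶ A.Z),
      IsBlowup π (vanishingIdeal D) → E.IsPermissibleCentre A.hom D → Rg A E → Rg A' (E.transform π D) →
      ((E.transform π D).sing ∩ π.base ⁻¹' (D : Set A.Z)).Finite ∧ ((E.transform π D).sing ∩ π.base ⁻¹' (D : Set A.Z)).ncard ≤ N) :
    FinLocalExitBound Rg := by
  classical
  refine ⟨fun A E _ => if h : E.sing.Finite then ∑ x ∈ h.toFinset, (N + 1) ^ w A E x else 0, fun r hr x s hs => ?_⟩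
  have hlen := FinPermissibleRun.len_le_potential_of_weight hfin hcl w N hoff hon hN r hr
  have hcard : s.card ≤ r.len := by
    calc s.card ≤ (Finset.range r.len).card :=
          Finset.card_le_card fun m hm => Finset.mem_range.mpr (hs m hm).1
      _ = r.len := Finset.card_range _
  dsimp only
  rw [dif_pos (hfin _ _ (hr 0 (Nat.zero_le _)))]
  exact hcard.trans hlen

end CampaignW46

end Summit.ResolutionOfSingularities.ResolutionOfSingularities.Theorems

end
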